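import Mathlib.Algebra.Group.Hom.Defs
import Mathlib.Algebra.Group.Pi.Lemmas
import Mathlib.Tactic.Abel
import HarnessLib

/-!
# Route `UnitScaleTilt`, crux K1 «MinimiserStabilityRegPr» (stmt-QuantumFields-19200), route-R E′ path (α′), (E1-a)∕(E1-e) seam: THE LINEAR CORRECTOR AS A MAP —
# `LinCorr : Y →+ X` (the letter `L` of `Prop7ExactCorrectorContractionGauge.exists_unique_exact_corrector_gauge`) manufactured from the tree's DISPLAYED corrector data
# (a longitudinal potential `Δ_Wφ = D*_WA` chosen arbitrarily + the pinned `Δ_W`-biharmonic interpolant of `φ|_C`) by existence-and-uniqueness alone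

Cell `ym3-torus`, width seat `ym3-torus-px13` (gen 3); (E1-e) socket scope (★p1 g15 round 4 standing PASS for (E1-a…e)), sequel of ✓p667460∕✓p667764∕✓p668999.
THEOREMS ONLY (0 `def`, 0 `sorry`, 0 `instance`); `--supports stmt-QuantumFields-19200`, count-neutral.  YM₃ on T³ is a ladder rung (R3), not the Clay problem; nothing here
claims the stub, the crux, d = 4 or the gap.  Pure additive-group algebra; no lattice object appears.

WHY.  The tree's corrector letters (✓`Prop7CentreHarmonicRegaugeSup(Cov)`: `A_H = A − D_W(φ − φ_H)` with DISPLAYED `φ`, `φ_H`) are relational: «some `φ` with `Δ_Wφ = D*_WA`,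
the interpolant `φ_H` of `φ|_C`».  The contraction door ✓p667460 wants a MAP `L : Y →+ X` (`ψ = L D + L (N ψ)` is iterated).  This file turns «uniquely solvable additive
problem» into «additive solution map» (§1) and applies it twice (§2): the interpolation map `I` from (existence ∀ data, uniqueness = ✓`Prop7PinnedBiharmonicUniqueness.interpolant_unique`
∕ its covariant twin), and the corrector `L A := φ − I φ` for ANY solution `φ` of `Δ_Wφ = D*_WA` — well defined because two solutions differ by a `Δ_W`-harmonic `h` and the
interpolant REPRODUCES harmonic fields (`I h = h`: `h` is its own pinned biharmonic interpolant), additive because sums of solutions solve the summed equation.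

WHAT IS PROVED (ns `…Theorems.Prop7LinearCorrectorMap`; `D`, `V`, `B` additive commutative groups).
* ★★ `exists_addMonoidHom_of_unique_solution` — a relation `P : D → V → Prop` with a solution for every datum, at most one, and additive graph defines `sol : D →+ V` with
  `P d (sol d)` and `P d v → v = sol d`.
* ★ `exists_interpolation_map` — the same read for an interpolation relation `IsInterp φ χ` («`χ` is the pinned interpolant of `φ`'s centre data»): `∃ I : V →+ V`, characterised.
* ★★★ `exists_linearCorrector` — from `Lap : V →+ V`, `Dstar : B →+ V`, `I : V →+ V`, solvability `∀ A, ∃ φ, Lap φ = Dstar A` and reproduction `Lap h = 0 → I h = h`: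
  `∃ L : B →+ V, ∀ A φ, Lap φ = Dstar A → L A = φ − I φ` (the corrector does not depend on the chosen potential).
* ★★ `exists_linearCorrector_of_interp` — the same with `I` itself produced from the interpolation relation (hypotheses: existence, uniqueness, additivity of the relation, and
  «a `Lap`-harmonic field interpolates itself»); output: `I`, `L` and both characterisations.
* `linearCorrector_vanishes_on` — for `V = S → 𝔸`: if interpolants agree with the data on `C` then `L A` vanishes on `C` (the door's pinning, `hLS` part 1).
HONEST SCOPE.  Algebra only; existence of potentials∕interpolants and the uniqueness theorem are the knit's inputs (tree: ✓`interpolant_unique`, (I-site)∕(I-site-cov), Green operators).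

References: T. Bałaban, CMP 102 (1985) 277–309 [Balaban1985Variational] (Prop. 7 p.299); CMP 99 (1985) 75–102 [Balaban1985RegularSpaces] ((1.14) p.78).
-/

set_option autoImplicit false

namespace Summit.QuantumFields.YangMills.Theorems.Prop7LinearCorrectorMap

/-! ## §1 A uniquely solvable additive problem defines an additive solution map -/

/-- ★★ If every datum `d` has exactly one solution `v` of `P d v` and the graph of `P` is additive, the solution assignment is an additive homomorphism `sol : D →+ V`,
characterised by `P d (sol d)` and `P d v → v = sol d`.  [cite: Balaban1985Variational, Prop. 7 p.299] -/
theorem exists_addMonoidHom_of_unique_solution {D V : Type*} [AddCommGroup D] [AddCommGroup V] (P : D → V → Prop)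
    (hex : ∀ d, ∃ v, P d v) (huniq : ∀ d v v', P d v → P d v' → v = v')
    (hadd : ∀ d d' v v', P d v → P d' v' → P (d + d') (v + v')) :
    ∃ sol : D →+ V, ∀ d, P d (sol d) ∧ ∀ v, P d v → v = sol d := by
  classical
  let f : D → V := fun d => Classical.choose (hex d)
  have hf : ∀ d, P d (f d) := fun d => Classical.choose_spec (hex d)
  have hfadd : ∀ a b, f (a + b) = f a + f b := fun a b =>
    huniq (a + b) _ _ (hf (a + b)) (hadd a b _ _ (hf a) (hf b))
  refine ⟨AddMonoidHom.mk' f hfadd, fun d => ⟨hf d, fun v hv => huniq d v (f d) hv (hf d)⟩⟩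

/-- ★ The interpolation map: if every field `φ` has exactly one «pinned interpolant of its centre data» `χ` (relation `IsInterp φ χ`, additive in `(φ, χ)`), then
`φ ↦ χ` is an additive homomorphism `I : V →+ V`, characterised.  [cite: Balaban1985RegularSpaces, (1.14) p.78] -/
theorem exists_interpolation_map {V : Type*} [AddCommGroup V] (IsInterp : V → V → Prop)
    (hex : ∀ φ, ∃ χ, IsInterp φ χ) (huniq : ∀ φ χ χ', IsInterp φ χ → IsInterp φ χ' → χ = χ')
    (hadd : ∀ φ φ' χ χ', IsInterp φ χ → IsInterp φ' χ' → IsInterp (φ + φ') (χ + χ')) :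
    ∃ I : V →+ V, ∀ φ, IsInterp φ (I φ) ∧ ∀ χ, IsInterp φ χ → χ = I φ :=
  exists_addMonoidHom_of_unique_solution IsInterp hex huniq hadd

/-! ## §2 The linear corrector `L A = φ − I φ` (any potential `φ` with `Lap φ = Dstar A`) -/

/-- ★★★ **THE LINEAR CORRECTOR AS A MAP.**  `Lap : V →+ V` (covariant Laplacian), `Dstar : B →+ V` (covariant divergence), `I : V →+ V` (pinned interpolation of centre data,
as a map on fields); if every `D*A` has a potential (`∃ φ, Lap φ = Dstar A`) and the interpolation reproduces `Lap`-harmonic fields (`Lap h = 0 → I h = h`), then there is an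
additive `L : B →+ V` with `L A = φ − I φ` for EVERY potential `φ` of `A`.  [cite: Balaban1985Variational, Prop. 7 p.299] -/
theorem exists_linearCorrector {V B : Type*} [AddCommGroup V] [AddCommGroup B] (Lap : V →+ V) (Dstar : B →+ V) (I : V →+ V)
    (hsolv : ∀ A, ∃ φ, Lap φ = Dstar A) (hker : ∀ h, Lap h = 0 → I h = h) :
    ∃ L : B →+ V, ∀ A φ, Lap φ = Dstar A → L A = φ - I φ := by
  -- the relation «ψ is the corrector of A»
  let P : B → V → Prop := fun A ψ => ∃ φ, Lap φ = Dstar A ∧ ψ = φ - I φ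
  have hex : ∀ A, ∃ ψ, P A ψ := fun A => by
    obtain ⟨φ, hφ⟩ := hsolv A
    exact ⟨φ - I φ, φ, hφ, rfl⟩
  have huniq : ∀ A ψ ψ', P A ψ → P A ψ' → ψ = ψ' := by
    rintro A ψ ψ' ⟨φ, hφ, rfl⟩ ⟨φ', hφ', rfl⟩
    have hh : Lap (φ - φ') = 0 := by rw [map_sub, hφ, hφ', sub_self]
    have hI : I (φ - φ') = φ - φ' := hker _ hh
    rw [map_sub] at hI
    -- (φ − Iφ) − (φ′ − Iφ′) = (φ − φ′) − (Iφ − Iφ′) = 0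
    have : (φ - I φ) - (φ' - I φ') = 0 := by
      calc (φ - I φ) - (φ' - I φ') = (φ - φ') - (I φ - I φ') := by abel
        _ = 0 := by rw [hI, sub_self]
    exact sub_eq_zero.mp this
  have hadd : ∀ A A' ψ ψ', P A ψ → P A' ψ' → P (A + A') (ψ + ψ') := by
    rintro A A' ψ ψ' ⟨φ, hφ, rfl⟩ ⟨φ', hφ', rfl⟩
    refine ⟨φ + φ', by rw [map_add, map_add, hφ, hφ'], ?_⟩
    rw [map_add]
    abel
  obtain ⟨L, hL⟩ := exists_addMonoidHom_of_unique_solution P hex huniq hadd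
  refine ⟨L, fun A φ hφ => ?_⟩
  exact ((hL A).2 (φ - I φ) ⟨φ, hφ, rfl⟩).symm

/-- ★★ The same with the interpolation map ITSELF manufactured from the interpolation relation: hypotheses = existence and uniqueness of interpolants, additivity of the
relation, and «a `Lap`-harmonic field is its own interpolant»; output = `I`, `L` and both characterisations.  [cite: Balaban1985Variational, Prop. 7 p.299] -/
theorem exists_linearCorrector_of_interp {V B : Type*} [AddCommGroup V] [AddCommGroup B] (Lap : V →+ V) (Dstar : B →+ V) (IsInterp : V → V → Prop)
    (hex : ∀ φ, ∃ χ, IsInterp φ χ) (huniq : ∀ φ χ χ', IsInterp φ χ → IsInterp φ χ' → χ = χ')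
    (hadd : ∀ φ φ' χ χ', IsInterp φ χ → IsInterp φ' χ' → IsInterp (φ + φ') (χ + χ'))
    (hharm : ∀ h, Lap h = 0 → IsInterp h h) (hsolv : ∀ A, ∃ φ, Lap φ = Dstar A) :
    ∃ I : V →+ V, ∃ L : B →+ V, (∀ φ, IsInterp φ (I φ) ∧ ∀ χ, IsInterp φ χ → χ = I φ) ∧
      ∀ A φ, Lap φ = Dstar A → L A = φ - I φ := by
  obtain ⟨I, hI⟩ := exists_interpolation_map IsInterp hex huniq hadd
  have hker : ∀ h, Lap h = 0 → I h = h := fun h hh => ((hI h).2 h (hharm h hh)).symm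
  obtain ⟨L, hL⟩ := exists_linearCorrector Lap Dstar I hsolv hker
  exact ⟨I, L, hI, hL⟩

/-- The corrector vanishes on the pinning set: for fields `S → 𝔸`, if every interpolant agrees with its datum on `C` then `L A c = 0` for `c ∈ C` (part 1 of the door's `hLS`).
[cite: Balaban1985RegularSpaces, (1.14) p.78] -/
theorem linearCorrector_vanishes_on {S 𝔸 B : Type*} [AddCommGroup 𝔸] [AddCommGroup B] (C : Set S) (Lap : (S → 𝔸) →+ (S → 𝔸)) (Dstar : B →+ (S → 𝔸))
    (I : (S → 𝔸) →+ (S → 𝔸)) (L : B →+ (S → 𝔸)) (hIC : ∀ φ, ∀ c ∈ C, I φ c = φ c) (hsolv : ∀ A, ∃ φ, Lap φ = Dstar A)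
    (hL : ∀ A φ, Lap φ = Dstar A → L A = φ - I φ) (A : B) : ∀ c ∈ C, L A c = 0 := by
  intro c hc
  obtain ⟨φ, hφ⟩ := hsolv A
  rw [hL A φ hφ, Pi.sub_apply, hIC φ c hc, sub_self]

end Summit.QuantumFields.YangMills.Theorems.Prop7LinearCorrectorMap
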